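import Summits.FinalStateConjecture.FinalStateConjecture.Theorems.StarvedNecksNecksCertifyStubSeamSurgeryRide
import Literature.Geometry.Lorentzian.CausalityPushUp


/-!
# Route StarvedNecks — crux `NecksCertify`, line `two-cap-focusing-ledger`: seam surgery, the covering clause

Helper file for the registered stub `stub_seamSurgery` (N2): the global covering clause
`diff_subset_causalPast` of the seamed decomposition from clause A13 of the atlas at the compatible
thresholds `(T, τ₁ + 5/2 + sⱼ)` (`covering_clause`), through the sharpened one-hole drainage
`drain_cover'`; plus the lab-clock rate along co-moving lines (`stub_seamSurgery_flatRate`,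
registered helper sub-goal, anchor of this file).

References: B. O'Neill, *Semi-Riemannian geometry*, Academic Press 1983, Ch. 14, pp. 402–403.
Mathlib + the landed `…StubSeamSurgeryRide` module; no definitions, no named facts.
-/

noncomputable section

open scoped Manifold ContDiff Topology ENNReal
open Filter Set Function Topology Literature.Geometry.Lorentzian

namespace Summit.FinalStateConjecture.FinalStateConjecture.Theorems.NecksCertifyTwoCap.Seam

set_option linter.dupNamespace false

open Summit.FinalStateConjecture.FinalStateConjecture.Theorems.SeamedChartsExhaust.WideAnchoring
  (radius_add_smul_e₀ poincareInv_add_smul causalPast_trans)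
open Summit.FinalStateConjecture.FinalStateConjecture.Theorems.SeamedChartsExhaust.Negative
  (line_mem_causalFuture)

/-- Registered helper sub-goal `stub_seamSurgery_flatRate` of N2 (anchor): along the co-moving line
`σ ↦ y + σ Λe₀` the lab clock moves at the constant rate `(Λe₀)⁰`. [folklore] -/
theorem stub_seamSurgery_flatRate :
    ∀ (Λ : lorentzGroup) (y : E4) (σ : ℝ), (y + σ • (Λ : E4 ≃L[ℝ] E4) (E4.basisVector 0)) 0 =
      y 0 + σ * ((Λ : E4 ≃L[ℝ] E4) (E4.basisVector 0)) 0 := by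
  intro Λ y σ
  simp

/-- **Draining the early collar of one hole to the slabs of the seamed decomposition**, sharpened
form of `drain_cover` of `…StubSeamSurgeryRide` (the flat-late alternative records that the flat
point is `x` itself).  For a point `x` of the re-gauged chart with hole time in `[τ₁ + 2 + s, T + s)`
and `r < Rg + 2`: either `Ψ' x` lies in `J⁻` of (the `Gl`-image of the re-clocked hole slab
`{t = T + s}` ∪ the flat slab `{y⁰ = T}` outside the tubes), or `x` is itself a flat-late point
outside the tubes with `Ψ' x = Φ x`.  O'Neill 1983, Ch. 14, p. 402. [folklore] -/
theorem drain_cover' {𝓢 : Spacetime.{0} 4} (Λ : lorentzGroup) (c : E4) (M a R₁ τ₁ s τf T : ℝ)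
    (hs : 0 ≤ s) (hτ : τf ≤ τ₁) (hT : τ₁ + 3 ≤ T)
    (hdomeq : ∀ y y' : E4, (boostedKerrBackground Λ c M a).radius y' = (boostedKerrBackground Λ c M a).radius y → y ∈ (boostedKerrBackground Λ c M a).domain → y' ∈ (boostedKerrBackground Λ c M a).domain)
    (Rg : ℝ → ℝ) (hRgm : Monotone Rg) (hRgc : Continuous Rg) (hRg4 : ∀ t, R₁ + 4 ≤ Rg t)
    (b : ℝ → ℝ) (hbm : Monotone b) (hbRg : ∀ t, Rg t + 21 / 20 ≤ b t ∧ b t ≤ Rg t + 29 / 20)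
    (Ψ Ψ' Gl : (boostedKerrBackground Λ c M a).domain → 𝓢.carrier)
    (hA1a : ContMDiffOn 𝓘(ℝ, E4) (𝓡 4) ∞ Ψ'
      {x | τ₁ < (boostedKerrBackground Λ c M a).time x ∧ (boostedKerrBackground Λ c M a).radius x < Rg ((boostedKerrBackground Λ c M a).time x) + 2})
    (hA2 : ∀ x : (boostedKerrBackground Λ c M a).domain, (boostedKerrBackground Λ c M a).radius x ≤ R₁ + 1 → Ψ' x = Ψ x)
    (hA8 : ∀ x : (boostedKerrBackground Λ c M a).domain, τ₁ ≤ (boostedKerrBackground Λ c M a).time x → R₁ ≤ (boostedKerrBackground Λ c M a).radius x →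
      (boostedKerrBackground Λ c M a).radius x ≤ Rg ((boostedKerrBackground Λ c M a).time x) + 2 →
      𝓢.timeOrientation.IsFutureDirected (mfderiv 𝓘(ℝ, E4) (𝓡 4) Ψ' x ((Λ : E4 ≃L[ℝ] E4) (E4.basisVector 0))))
    (hHc2 : ∀ ϱ τ₂ : ℝ, R₁ ≤ ϱ → τf < τ₂ →
      Ψ '' {x | τf < (boostedKerrBackground Λ c M a).time x ∧ (boostedKerrBackground Λ c M a).time x < τ₂ ∧ (boostedKerrBackground Λ c M a).radius x < ϱ} ⊆
        𝓢.metric.causalPast 𝓢.timeOrientation (Ψ '' (boostedKerrBackground Λ c M a).truncTimeSlab ϱ τ₂))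
    (W₀ : TopologicalSpace.Opens E4) (Φ : W₀ → 𝓢.carrier) (P : E4 → Prop)
    (hA3 : ∀ (y : E4) (hy : y ∈ (boostedKerrBackground Λ c M a).domain), τ₁ ≤ y 0 → P y →
      (boostedKerrBackground Λ c M a).radius y ≤ Rg ((boostedKerrBackground Λ c M a).time y) + 2 → ∃ hw : y ∈ W₀, Ψ' ⟨y, hy⟩ = Φ ⟨y, hw⟩)
    (hcollar : ∀ y : E4, y ∈ (boostedKerrBackground Λ c M a).domain → τ₁ + 1 + s < (boostedKerrBackground Λ c M a).time y →
      Rg ((boostedKerrBackground Λ c M a).time y) + 17 / 20 < (boostedKerrBackground Λ c M a).radius y → (boostedKerrBackground Λ c M a).radius y < Rg ((boostedKerrBackground Λ c M a).time y) + 2 →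
      τ₁ ≤ y 0 ∧ τf < y 0 ∧ P y)
    (hGl2 : ∀ x : (boostedKerrBackground Λ c M a).domain, τ₁ + 2 + s ≤ (boostedKerrBackground Λ c M a).time x → (boostedKerrBackground Λ c M a).radius x < b ((boostedKerrBackground Λ c M a).time x) →
      Gl x = Ψ' x)
    (horth : 0 < ((Λ : E4 ≃L[ℝ] E4) (E4.basisVector 0)) 0)
    (hlag : ∀ y : E4, τ₁ ≤ (boostedKerrBackground Λ c M a).time y → (boostedKerrBackground Λ c M a).radius y ≤ Rg ((boostedKerrBackground Λ c M a).time y) + 2 → (boostedKerrBackground Λ c M a).time y - s ≤ y 0)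
    (htube : ∀ y : E4, y ∈ (boostedKerrBackground Λ c M a).domain → τ₁ ≤ y 0 → (boostedKerrBackground Λ c M a).radius y ≤ Rg ((boostedKerrBackground Λ c M a).time y) + 2 → ¬ P y →
      (boostedKerrBackground Λ c M a).radius y + 3 ≤ Rg ((boostedKerrBackground Λ c M a).time y))
    (x : E4) (hx : x ∈ (boostedKerrBackground Λ c M a).domain) (htx : τ₁ + 2 + s ≤ (boostedKerrBackground Λ c M a).time x) (htx2 : (boostedKerrBackground Λ c M a).time x < T + s)
    (hrx : (boostedKerrBackground Λ c M a).radius x < Rg ((boostedKerrBackground Λ c M a).time x) + 2) :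
    Ψ' ⟨x, hx⟩ ∈ 𝓢.metric.causalPast 𝓢.timeOrientation
        (Gl '' {y | (boostedKerrBackground Λ c M a).time y = T + s} ∪ Φ '' {w : W₀ | w.1 0 = T ∧ P w.1}) ∨
      (T < x 0 ∧ ∃ hw : x ∈ W₀, Ψ' ⟨x, hx⟩ = Φ ⟨x, hw⟩ ∧ P x) := by
  have htv : ∀ (y : E4) (σ' : ℝ), (boostedKerrBackground Λ c M a).time (y + σ' • (Λ : E4 ≃L[ℝ] E4) (E4.basisVector 0)) =
      (boostedKerrBackground Λ c M a).time y + σ' := fun y σ' ↦ by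
    show poincareInv Λ c (y + σ' • (Λ : E4 ≃L[ℝ] E4) (E4.basisVector 0)) 0 = poincareInv Λ c y 0 + σ'
    rw [poincareInv_add_smul]; simp
  have hrv : ∀ (y : E4) (σ' : ℝ), (boostedKerrBackground Λ c M a).radius (y + σ' • (Λ : E4 ≃L[ℝ] E4) (E4.basisVector 0)) =
      (boostedKerrBackground Λ c M a).radius y := fun y σ' ↦ by
    show Kerr.radius a (poincareInv Λ c (y + σ' • (Λ : E4 ≃L[ℝ] E4) (E4.basisVector 0))) =
      Kerr.radius a (poincareInv Λ c y)
    rw [poincareInv_add_smul, radius_add_smul_e₀]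
  have hb5 : ∀ t, R₁ + 5 ≤ b t := fun t ↦ by linarith [(hbRg t).1, hRg4 t]
  have hflat : ∀ (y : E4) (σ' : ℝ), (y + σ' • (Λ : E4 ≃L[ℝ] E4) (E4.basisVector 0)) 0 =
      y 0 + σ' * ((Λ : E4 ≃L[ℝ] E4) (E4.basisVector 0)) 0 := fun y σ' ↦ by simp
  have hτfx : τf < (boostedKerrBackground Λ c M a).time x := by linarith
  rcases lt_or_ge ((boostedKerrBackground Λ c M a).radius x) (R₁ + 1 / 4) with hsmall | hbig
  · -- inside `R₁ + 1/4`
    left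
    have hΨx : Ψ' ⟨x, hx⟩ = Ψ ⟨x, hx⟩ := hA2 ⟨x, hx⟩ (by show (boostedKerrBackground Λ c M a).radius x ≤ _; linarith)
    have h1 := hHc2 (R₁ + 1 / 2) (T + s) (by linarith) (by linarith)
      ⟨⟨x, hx⟩, ⟨hτfx, htx2, by show (boostedKerrBackground Λ c M a).radius x < _; linarith⟩, rfl⟩
    rw [hΨx]
    refine LorentzianMetric.causalFuture_mono ?_ h1
    rintro _ ⟨y, ⟨hyt, hyr⟩, rfl⟩
    have hyt' : (boostedKerrBackground Λ c M a).time y = T + s := hyt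
    have hyr' : (boostedKerrBackground Λ c M a).radius y ≤ R₁ + 1 / 2 := hyr
    refine Or.inl ⟨y, hyt', ?_⟩
    rw [hGl2 y (by rw [hyt']; linarith) (by linarith [hb5 ((boostedKerrBackground Λ c M a).time y)]), hA2 y (by linarith)]
  · rcases lt_or_ge ((boostedKerrBackground Λ c M a).radius x) (b ((boostedKerrBackground Λ c M a).time x)) with hin | hout
    · -- on the certified tube: ride to hole time `T + s`
      left
      have hu : 0 ≤ T + s - (boostedKerrBackground Λ c M a).time x := by linarith
      have hmem : x + (T + s - (boostedKerrBackground Λ c M a).time x) • (Λ : E4 ≃L[ℝ] E4) (E4.basisVector 0) ∈ (boostedKerrBackground Λ c M a).domain :=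
        hdomeq x _ (hrv x _) hx
      have hride := ride_mem_causalFuture Λ c M a R₁ τ₁ Rg hRgm hRgc Ψ' hA1a hA8 hdomeq x hx
        (by linarith) (by linarith) hrx _ hu hmem
      have hte : (boostedKerrBackground Λ c M a).time (x + (T + s - (boostedKerrBackground Λ c M a).time x) • (Λ : E4 ≃L[ℝ] E4) (E4.basisVector 0)) =
          T + s := by rw [htv]; ring
      have hre := hrv x (T + s - (boostedKerrBackground Λ c M a).time x)
      have hGle : Gl ⟨_, hmem⟩ = Ψ' ⟨_, hmem⟩ := hGl2 _ (by show _ ≤ (boostedKerrBackground Λ c M a).time _; rw [hte]; linarith)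
        (by show (boostedKerrBackground Λ c M a).radius _ < b ((boostedKerrBackground Λ c M a).time _); rw [hre, hte]; exact hin.trans_le (hbm (by linarith)))
      refine LorentzianMetric.causalFuture_mono ?_
        (LorentzianMetric.mem_causalPast_of_mem_causalFuture hride)
      rintro _ rfl
      exact Or.inl ⟨⟨_, hmem⟩, hte, hGle⟩
    · -- on and beyond the shell: `Ψ' x` is a flat point outside the tubes
      obtain ⟨hx0, hxf, hPx⟩ := hcollar x hx (by linarith) (by linarith [(hbRg ((boostedKerrBackground Λ c M a).time x)).1]) hrx
      obtain ⟨hwx, hΨx⟩ := hA3 x hx hx0 hPx hrx.le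
      rcases lt_trichotomy T (x 0) with hgt | heq | hlt
      · right
        exact ⟨hgt, hwx, hΨx, hPx⟩
      · left
        rw [hΨx]
        exact LorentzianMetric.subset_causalPast _ _ _ (Or.inr ⟨⟨x, hwx⟩, ⟨heq.symm, hPx⟩, rfl⟩)
      · left
        -- ride from `x` until flat time `T`
        set γ : ℝ := ((Λ : E4 ≃L[ℝ] E4) (E4.basisVector 0)) 0 with hγ
        set u₁ : ℝ := T + s - (boostedKerrBackground Λ c M a).time x with hu₁
        set us : ℝ := (T - x 0) / γ with hus
        have hus0 : 0 ≤ us := div_nonneg (by linarith) horth.le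
        have hu₁0 : 0 < u₁ := by rw [hu₁]; linarith
        have hmem : ∀ u : ℝ, x + u • (Λ : E4 ≃L[ℝ] E4) (E4.basisVector 0) ∈ (boostedKerrBackground Λ c M a).domain := fun u ↦
          hdomeq x _ (hrv x _) hx
        have hrideu : ∀ u : ℝ, 0 ≤ u →
            Ψ' ⟨x + u • (Λ : E4 ≃L[ℝ] E4) (E4.basisVector 0), hmem u⟩ ∈
              𝓢.metric.causalFuture 𝓢.timeOrientation {Ψ' ⟨x, hx⟩} := fun u hu ↦
          ride_mem_causalFuture Λ c M a R₁ τ₁ Rg hRgm hRgc Ψ' hA1a hA8 hdomeq x hx (by linarith)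
            (by linarith [hb5 ((boostedKerrBackground Λ c M a).time x)]) hrx u hu (hmem u)
        -- the flat time `T` is reached before hole time `T + s`
        have hte₁ : (boostedKerrBackground Λ c M a).time (x + u₁ • (Λ : E4 ≃L[ℝ] E4) (E4.basisVector 0)) = T + s := by
          rw [htv, hu₁]; ring
        have hre₁ := hrv x u₁
        have hlag₁ := hlag (x + u₁ • (Λ : E4 ≃L[ℝ] E4) (E4.basisVector 0)) (by rw [hte₁]; linarith)
          (by rw [hre₁, hte₁]; linarith [hRgm (show (boostedKerrBackground Λ c M a).time x ≤ T + s by linarith)])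
        rw [hte₁, hflat] at hlag₁
        have husu₁ : us ≤ u₁ := by
          rw [hus, div_le_iff₀ horth]
          linarith
        have hflat_e : (x + us • (Λ : E4 ≃L[ℝ] E4) (E4.basisVector 0)) 0 = T := by
          rw [hflat, hus, div_mul_cancel₀ _ horth.ne']
          ring
        have hte : (boostedKerrBackground Λ c M a).time (x + us • (Λ : E4 ≃L[ℝ] E4) (E4.basisVector 0)) = (boostedKerrBackground Λ c M a).time x + us :=
          htv x us
        have hre := hrv x us
        have hte' : (boostedKerrBackground Λ c M a).time x ≤ (boostedKerrBackground Λ c M a).time (x + us • (Λ : E4 ≃L[ℝ] E4) (E4.basisVector 0)) := by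
          rw [hte]; linarith
        have hrRg : (boostedKerrBackground Λ c M a).radius (x + us • (Λ : E4 ≃L[ℝ] E4) (E4.basisVector 0)) ≤
            Rg ((boostedKerrBackground Λ c M a).time (x + us • (Λ : E4 ≃L[ℝ] E4) (E4.basisVector 0))) + 2 := by
          rw [hre]; linarith [hRgm hte']
        by_cases hPe : P (x + us • (Λ : E4 ≃L[ℝ] E4) (E4.basisVector 0))
        · obtain ⟨hwe, hΨe⟩ := hA3 _ (hmem us) (by rw [hflat_e]; linarith) hPe hrRg
          refine LorentzianMetric.causalFuture_mono ?_
            (LorentzianMetric.mem_causalPast_of_mem_causalFuture (hrideu us hus0))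
          rintro _ rfl
          exact Or.inr ⟨⟨_, hwe⟩, ⟨hflat_e, hPe⟩, hΨe.symm⟩
        · have hdeep := htube _ (hmem us) (by rw [hflat_e]; linarith) hrRg hPe
          rw [hre, hte] at hdeep
          have hGle : Gl ⟨_, hmem u₁⟩ = Ψ' ⟨_, hmem u₁⟩ := hGl2 _
            (by show _ ≤ (boostedKerrBackground Λ c M a).time _; rw [hte₁]; linarith)
            (by show (boostedKerrBackground Λ c M a).radius _ < b ((boostedKerrBackground Λ c M a).time _); rw [hre₁, hte₁]
                linarith [hb5 (T + s), (hbRg (T + s)).1,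
                  hRgm (show (boostedKerrBackground Λ c M a).time x + us ≤ T + s by rw [hu₁] at husu₁; linarith)])
          refine LorentzianMetric.causalFuture_mono ?_
            (LorentzianMetric.mem_causalPast_of_mem_causalFuture (hrideu u₁ hu₁0.le))
          rintro _ rfl
          exact Or.inl ⟨⟨_, hmem u₁⟩, hte₁, hGle⟩


/-- **The covering clause of the seamed decomposition.**  Given clause A13 of the atlas at the
compatible thresholds `(T, τ₁ + 5/2 + sⱼ)`, every point of `O` outside the late images of the new
charts (`Glⱼ{tⱼ > T + sⱼ}` and the flat chart on `{y⁰ > T}` outside the tubes) lies in `J⁻` of the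
images of their initial slabs: points of the late A13-atlas are late points of the new charts or
drain (`drain_cover'`); points below the A13-slabs drain through them (`J⁻` is transitive).
O'Neill 1983, Ch. 14, pp. 402–403. [folklore] -/
theorem covering_clause {𝓢 : Spacetime.{0} 4} (N : ℕ) (Λ : Fin N → lorentzGroup) (c : Fin N → E4) (M a : Fin N → ℝ) (R₁ τ₁ τf T : ℝ) (s : Fin N → ℝ)
    (hs : ∀ j, 0 ≤ s j) (hτ : τf ≤ τ₁) (hT : τ₁ + 3 ≤ T)
    (hdomeq : ∀ j (y y' : E4), (boostedKerrBackground (Λ j) (c j) (M j) (a j)).radius y' = (boostedKerrBackground (Λ j) (c j) (M j) (a j)).radius y → y ∈ (boostedKerrBackground (Λ j) (c j) (M j) (a j)).domain → y' ∈ (boostedKerrBackground (Λ j) (c j) (M j) (a j)).domain)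
    (Rg : Fin N → ℝ → ℝ) (hRgm : ∀ j, Monotone (Rg j)) (hRgc : ∀ j, Continuous (Rg j))
    (hRg4 : ∀ j t, R₁ + 4 ≤ Rg j t)
    (b : Fin N → ℝ → ℝ) (hbm : ∀ j, Monotone (b j))
    (hbRg : ∀ j t, Rg j t + 21 / 20 ≤ b j t ∧ b j t ≤ Rg j t + 29 / 20)
    (Ψ Ψ' Gl : ∀ j, (boostedKerrBackground (Λ j) (c j) (M j) (a j)).domain → 𝓢.carrier)
    (hA1a : ∀ j, ContMDiffOn 𝓘(ℝ, E4) (𝓡 4) ∞ (Ψ' j)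
      {x | τ₁ < (boostedKerrBackground (Λ j) (c j) (M j) (a j)).time x ∧ (boostedKerrBackground (Λ j) (c j) (M j) (a j)).radius x < Rg j ((boostedKerrBackground (Λ j) (c j) (M j) (a j)).time x) + 2})
    (hA2 : ∀ j (x : (boostedKerrBackground (Λ j) (c j) (M j) (a j)).domain), (boostedKerrBackground (Λ j) (c j) (M j) (a j)).radius x ≤ R₁ + 1 → Ψ' j x = Ψ j x)
    (hA8 : ∀ j (x : (boostedKerrBackground (Λ j) (c j) (M j) (a j)).domain), τ₁ ≤ (boostedKerrBackground (Λ j) (c j) (M j) (a j)).time x → R₁ ≤ (boostedKerrBackground (Λ j) (c j) (M j) (a j)).radius x →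
      (boostedKerrBackground (Λ j) (c j) (M j) (a j)).radius x ≤ Rg j ((boostedKerrBackground (Λ j) (c j) (M j) (a j)).time x) + 2 →
      𝓢.timeOrientation.IsFutureDirected
        (mfderiv 𝓘(ℝ, E4) (𝓡 4) (Ψ' j) x ((Λ j : E4 ≃L[ℝ] E4) (E4.basisVector 0))))
    (hHc2 : ∀ j (ϱ τ₂ : ℝ), R₁ ≤ ϱ → τf < τ₂ →
      Ψ j '' {x | τf < (boostedKerrBackground (Λ j) (c j) (M j) (a j)).time x ∧ (boostedKerrBackground (Λ j) (c j) (M j) (a j)).time x < τ₂ ∧ (boostedKerrBackground (Λ j) (c j) (M j) (a j)).radius x < ϱ} ⊆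
        𝓢.metric.causalPast 𝓢.timeOrientation (Ψ j '' (boostedKerrBackground (Λ j) (c j) (M j) (a j)).truncTimeSlab ϱ τ₂))
    (W₀ : TopologicalSpace.Opens E4) (Φ : W₀ → 𝓢.carrier) (P : E4 → Prop)
    (hA3 : ∀ j (y : E4) (hy : y ∈ (boostedKerrBackground (Λ j) (c j) (M j) (a j)).domain), τ₁ ≤ y 0 → P y →
      (boostedKerrBackground (Λ j) (c j) (M j) (a j)).radius y ≤ Rg j ((boostedKerrBackground (Λ j) (c j) (M j) (a j)).time y) + 2 → ∃ hw : y ∈ W₀, Ψ' j ⟨y, hy⟩ = Φ ⟨y, hw⟩)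
    (hcollar : ∀ j (y : E4), y ∈ (boostedKerrBackground (Λ j) (c j) (M j) (a j)).domain → τ₁ + 1 + s j < (boostedKerrBackground (Λ j) (c j) (M j) (a j)).time y →
      Rg j ((boostedKerrBackground (Λ j) (c j) (M j) (a j)).time y) + 17 / 20 < (boostedKerrBackground (Λ j) (c j) (M j) (a j)).radius y → (boostedKerrBackground (Λ j) (c j) (M j) (a j)).radius y < Rg j ((boostedKerrBackground (Λ j) (c j) (M j) (a j)).time y) + 2 →
      τ₁ ≤ y 0 ∧ τf < y 0 ∧ P y)
    (hGl2 : ∀ j (x : (boostedKerrBackground (Λ j) (c j) (M j) (a j)).domain), τ₁ + 2 + s j ≤ (boostedKerrBackground (Λ j) (c j) (M j) (a j)).time x → (boostedKerrBackground (Λ j) (c j) (M j) (a j)).radius x < b j ((boostedKerrBackground (Λ j) (c j) (M j) (a j)).time x) →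
      Gl j x = Ψ' j x)
    (horth : ∀ j, 0 < ((Λ j : E4 ≃L[ℝ] E4) (E4.basisVector 0)) 0)
    (hlag : ∀ j (y : E4), τ₁ ≤ (boostedKerrBackground (Λ j) (c j) (M j) (a j)).time y → (boostedKerrBackground (Λ j) (c j) (M j) (a j)).radius y ≤ Rg j ((boostedKerrBackground (Λ j) (c j) (M j) (a j)).time y) + 2 → (boostedKerrBackground (Λ j) (c j) (M j) (a j)).time y - s j ≤ y 0)
    (htube : ∀ j (y : E4), y ∈ (boostedKerrBackground (Λ j) (c j) (M j) (a j)).domain → τ₁ ≤ y 0 → (boostedKerrBackground (Λ j) (c j) (M j) (a j)).radius y ≤ Rg j ((boostedKerrBackground (Λ j) (c j) (M j) (a j)).time y) + 2 → ¬ P y →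
      (boostedKerrBackground (Λ j) (c j) (M j) (a j)).radius y + 3 ≤ Rg j ((boostedKerrBackground (Λ j) (c j) (M j) (a j)).time y))
    (hY : ∀ j (y : E4), T < y 0 → (boostedKerrBackground (Λ j) (c j) (M j) (a j)).radius y ≤ Rg j ((boostedKerrBackground (Λ j) (c j) (M j) (a j)).time y) + 2 → τ₁ + 3 ≤ (boostedKerrBackground (Λ j) (c j) (M j) (a j)).time y - s j)
    (O : Set 𝓢.carrier)
    (hA13 : O \ (Φ '' {y : W₀ | T < y.1 0 ∧ P y.1} ∪
        ⋃ j, Ψ' j '' {x | τ₁ + 5 / 2 + s j < (boostedKerrBackground (Λ j) (c j) (M j) (a j)).time x ∧ (boostedKerrBackground (Λ j) (c j) (M j) (a j)).radius x < Rg j ((boostedKerrBackground (Λ j) (c j) (M j) (a j)).time x) + 2}) ⊆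
      𝓢.metric.causalPast 𝓢.timeOrientation (Φ '' {y : W₀ | y.1 0 = T ∧ P y.1} ∪
        ⋃ j, Ψ' j '' {x | (boostedKerrBackground (Λ j) (c j) (M j) (a j)).time x = τ₁ + 5 / 2 + s j ∧ (boostedKerrBackground (Λ j) (c j) (M j) (a j)).radius x < Rg j ((boostedKerrBackground (Λ j) (c j) (M j) (a j)).time x) + 2})) :
    O \ ((⋃ j, Gl j '' {x | T + s j < (boostedKerrBackground (Λ j) (c j) (M j) (a j)).time x}) ∪ Φ '' {y : W₀ | T < y.1 0 ∧ P y.1}) ⊆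
      𝓢.metric.causalPast 𝓢.timeOrientation
        ((⋃ j, Gl j '' {x | (boostedKerrBackground (Λ j) (c j) (M j) (a j)).time x = T + s j}) ∪ Φ '' {y : W₀ | y.1 0 = T ∧ P y.1}) := by
  rintro q ⟨hqO, hqnot⟩
  -- abbreviations of the four sets
  set HS : Set 𝓢.carrier := ⋃ j, Gl j '' {x | (boostedKerrBackground (Λ j) (c j) (M j) (a j)).time x = T + s j} with hHS
  set FS : Set 𝓢.carrier := Φ '' {y : W₀ | y.1 0 = T ∧ P y.1} with hFS
  have hb5 : ∀ j t, R₁ + 5 ≤ b j t := fun j t ↦ by linarith [(hbRg j t).1, hRg4 j t]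
  -- one-hole drains into `HS ∪ FS`
  have hdrain : ∀ j (x : E4) (hx : x ∈ (boostedKerrBackground (Λ j) (c j) (M j) (a j)).domain), τ₁ + 2 + s j ≤ (boostedKerrBackground (Λ j) (c j) (M j) (a j)).time x →
      (boostedKerrBackground (Λ j) (c j) (M j) (a j)).time x < T + s j → (boostedKerrBackground (Λ j) (c j) (M j) (a j)).radius x < Rg j ((boostedKerrBackground (Λ j) (c j) (M j) (a j)).time x) + 2 →
      Ψ' j ⟨x, hx⟩ ∈ 𝓢.metric.causalPast 𝓢.timeOrientation (HS ∪ FS) ∨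
        (T < x 0 ∧ ∃ hw : x ∈ W₀, Ψ' j ⟨x, hx⟩ = Φ ⟨x, hw⟩ ∧ P x) := by
    intro j x hx h1 h2 h3
    rcases drain_cover' (Λ j) (c j) (M j) (a j) R₁ τ₁ (s j) τf T (hs j) hτ hT (hdomeq j) (Rg j)
      (hRgm j) (hRgc j) (hRg4 j) (b j) (hbm j) (hbRg j) (Ψ j) (Ψ' j) (Gl j) (hA1a j) (hA2 j) (hA8 j)
      (hHc2 j) W₀ Φ P (hA3 j) (hcollar j) (hGl2 j) (horth j) (hlag j) (htube j) x hx h1 h2 h3 with h | h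
    · left
      refine LorentzianMetric.causalFuture_mono ?_ h
      rintro w (⟨y, hy, rfl⟩ | ⟨y, hy, rfl⟩)
      · exact Or.inl (mem_iUnion.mpr ⟨j, y, hy, rfl⟩)
      · exact Or.inr ⟨y, hy, rfl⟩
    · exact Or.inr h
  by_cases hq1 : q ∈ Φ '' {y : W₀ | T < y.1 0 ∧ P y.1} ∪
      ⋃ j, Ψ' j '' {x | τ₁ + 5 / 2 + s j < (boostedKerrBackground (Λ j) (c j) (M j) (a j)).time x ∧ (boostedKerrBackground (Λ j) (c j) (M j) (a j)).radius x < Rg j ((boostedKerrBackground (Λ j) (c j) (M j) (a j)).time x) + 2}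
  · rcases hq1 with hq1 | hq1
    · exact (hqnot (Or.inr hq1)).elim
    · obtain ⟨j, hj⟩ := mem_iUnion.mp hq1
      obtain ⟨x, ⟨hxt, hxr⟩, rfl⟩ := hj
      have hxt' : τ₁ + 5 / 2 + s j < (boostedKerrBackground (Λ j) (c j) (M j) (a j)).time x := hxt
      have hxr' : (boostedKerrBackground (Λ j) (c j) (M j) (a j)).radius x < Rg j ((boostedKerrBackground (Λ j) (c j) (M j) (a j)).time x) + 2 := hxr
      rcases lt_trichotomy ((boostedKerrBackground (Λ j) (c j) (M j) (a j)).time x) (T + s j) with hlt | heq | hgt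
      · rcases hdrain j x x.2 (by linarith) hlt hxr' with h | ⟨hx0, hw, hΨ, hPx⟩
        · exact h
        · exact (hqnot (Or.inr ⟨⟨x, hw⟩, ⟨hx0, hPx⟩, hΨ.symm⟩)).elim
      · -- on the hole slab
        rcases lt_or_ge ((boostedKerrBackground (Λ j) (c j) (M j) (a j)).radius x) (b j ((boostedKerrBackground (Λ j) (c j) (M j) (a j)).time x)) with hin | hout
        · refine LorentzianMetric.subset_causalPast _ _ _ (Or.inl (mem_iUnion.mpr ⟨j, x, heq, ?_⟩))
          exact hGl2 j x (by linarith) hin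
        · obtain ⟨hx0, hxf, hPx⟩ := hcollar j x x.2 (by linarith [hs j])
            (by linarith [(hbRg j ((boostedKerrBackground (Λ j) (c j) (M j) (a j)).time x)).1]) hxr'
          obtain ⟨hw, hΨ⟩ := hA3 j x x.2 hx0 hPx hxr'.le
          have hlg := hlag j x (by linarith [hs j]) hxr'.le
          rcases eq_or_lt_of_le (show T ≤ x.1 0 by linarith) with h0 | h0
          · refine LorentzianMetric.subset_causalPast _ _ _ (Or.inr ⟨⟨x, hw⟩, ⟨h0.symm, hPx⟩, ?_⟩)
            exact hΨ.symm
          · exact (hqnot (Or.inr ⟨⟨x, hw⟩, ⟨h0, hPx⟩, hΨ.symm⟩)).elim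
      · -- late for the new decomposition
        rcases lt_or_ge ((boostedKerrBackground (Λ j) (c j) (M j) (a j)).radius x) (b j ((boostedKerrBackground (Λ j) (c j) (M j) (a j)).time x)) with hin | hout
        · refine (hqnot (Or.inl (mem_iUnion.mpr ⟨j, x, hgt, ?_⟩))).elim
          exact hGl2 j x (by linarith) hin
        · obtain ⟨hx0, hxf, hPx⟩ := hcollar j x x.2 (by linarith [hs j])
            (by linarith [(hbRg j ((boostedKerrBackground (Λ j) (c j) (M j) (a j)).time x)).1]) hxr'
          obtain ⟨hw, hΨ⟩ := hA3 j x x.2 hx0 hPx hxr'.le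
          have hlg := hlag j x (by linarith [hs j]) hxr'.le
          exact (hqnot (Or.inr ⟨⟨x, hw⟩, ⟨by linarith, hPx⟩, hΨ.symm⟩)).elim
  · -- below the A13 slabs
    have hJ := hA13 ⟨hqO, hq1⟩
    have hJ' : q ∈ 𝓢.metric.causalFuture 𝓢.timeOrientation.reverse _ := hJ
    rw [LorentzianMetric.causalFuture_eq_biUnion] at hJ'
    simp only [mem_iUnion, exists_prop] at hJ'
    obtain ⟨w, hw, hqw⟩ := hJ'
    refine causalPast_trans hqw ?_
    rcases hw with ⟨y, ⟨hy0, hPy⟩, rfl⟩ | hw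
    · exact LorentzianMetric.subset_causalPast _ _ _ (Or.inr ⟨y, ⟨hy0, hPy⟩, rfl⟩)
    · obtain ⟨j, hj⟩ := mem_iUnion.mp hw
      obtain ⟨x, ⟨hxt, hxr⟩, rfl⟩ := hj
      have hxt' : (boostedKerrBackground (Λ j) (c j) (M j) (a j)).time x = τ₁ + 5 / 2 + s j := hxt
      have hxr' : (boostedKerrBackground (Λ j) (c j) (M j) (a j)).radius x < Rg j ((boostedKerrBackground (Λ j) (c j) (M j) (a j)).time x) + 2 := hxr
      rcases hdrain j x x.2 (by linarith) (by linarith) hxr' with h | ⟨hx0, -, -, -⟩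
      · exact h
      · have := hY j x hx0 hxr'.le
        linarith


end Summit.FinalStateConjecture.FinalStateConjecture.Theorems.NecksCertifyTwoCap.Seam

end
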